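import Summits.QuantumFields.BalabanUV.T4Continuum.Support.VariationalVectorGaugeSlice
import Summits.QuantumFields.BalabanUV.T4Continuum.Support.ScalarBlockTrialFunction

/-!
# T⁴ programme, spine node NE2 (U1a), lane P2 — leaf V-REG WITH BACKGROUND, file 1/3: THE COVARIANT REVERSE POINCARÉ INEQUALITY behind the
# BLOCK-HARMONIC COMPLEMENT `S_R(K)ᗮ` of Bałaban's projected gauge functional `projG R K` — ANY contractive bond transports `R`, NO curvature hypothesis:
# `n²·Σ_μ ‖D_μ u‖² ≤ 4d·36^d·(1 + n·w)²·‖u‖²` whenever `div_R D_R u` has block-constant norm and in-block covariant differences `≤ w·‖·‖`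
# (model level, general Hilbert `E`; file 2/3 `CovariantSliceComplement` shows this is exactly `div_R D_R u ⊥ ker Q_{T′}` and draws the consequences)

NE2 formalisation swarm `b2b-balaban-t4-ne2-formalise-*`, leaf prover 03 GEN 6 (`prover-b2b-balaban-t4-ne2-formalise-leaf-03-g6-0`); journal INTENT
CLAIMS.log 2026-08-20 16:20Z «V-REG WITH BACKGROUND».  Successor item 1 of gen 5's hand-over: `VariationalVectorRegularityRho.hREG_rhoV` (p222597) displays the
binder (REG-G) «the gauge form's gradient is the gradient of the divergence up to a form-bounded remainder»; gen 5 discharged it at `U = 1` for Bałaban's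
functional through the substrate's factorisation `∂·PcT·∂ᴴ = X·K⁻¹·Xᴴ` (`VariationalVectorRegularityFlat`, p224569).  WITH BACKGROUND the defect of leaf-09-g7's
`projG R K W = ‖Π_{S_R(K)} div_R W‖²` (p221888; `S_R(K) = div_R D_R (K)`) is `D_R Π_{S_R(K)ᗮ} div_R W`, and by duality (`X = A†A`, `A = Π_{Sᗮ} div_R`) its size
is governed by ONE number, the reverse Poincaré constant `sup {‖D_R u‖²/‖u‖² : u ∈ S_R(K)ᗮ}`; and `u ∈ S_R(K)ᗮ` iff `div_R D_R u ⊥ K`, i.e. (for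
`K = ker Q_{T′}`, unitary `T′`) iff `div_R D_R u` is COVARIANTLY BLOCK-CONSTANT `x ↦ T′(x)⋆ g(block x)` — a field with block-constant norm whose in-block
covariant differences are the road's mismatch class `‖R(x,μ)∘T′(x+e_μ)⋆∘T′(x) − 1‖ ≤ w`.  THIS FILE bounds the constant for such `u`.

THE MATHEMATICS ([folklore]; elementary duality + the lattice bookkeeping of leaf-09's `ScalarBlockTrialFunction`, support row B4.c, BY NAME).
 * §1 (any torus `N`) the TEST-FUNCTION INEQUALITY `Re⟪ψ, div_R D_R u⟫ = Re Σ_μ ⟪D_μψ, D_μu⟫ ≤ ‖D_Rψ‖·‖D_R u‖` (`re_ipv_negLapv_le`, from leaf-09-g4's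
   adjointness `VariationalColourBochner.ipv_DirAdjv`), `Σ_μ‖D_μu‖² = Re⟪u, div_R D_R u⟫` (`sum_nsqv_Dirv_eq_re`), symmetry `ipv_negLapv_comm`, and the two
   real-number steps `sq_mul_le_of_le_sqrt` ∕ `mul_le_of_sqrt_chain`.
 * §2 (block torus `fine n M`) the BUMPED field `bumped f := β·f`, `β(x) = Π_ν b(digit_ν x)`, `b(t) = (t+1)(n−t)/n²` (leaf-09's `bumpW ∘ digits`: `0 ≤ β ≤ 1`,
   face values `1/n`, `|n·Δb| ≤ 1`, block mean `β₁^d`, `β₁ ≥ 1/6`): for a field `f` with BLOCK-CONSTANT NORM `Re⟪β·f, f⟫ = β₁^d·‖f‖²` (`re_ipv_bumped`); for ANY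
   `f` with in-block covariant differences `≤ w‖f x‖` and contractive `R`, `Σ_μ‖D_μ(β·f)‖² ≤ 4d(1/n + w)²‖f‖²` (`sum_nsqv_Dirv_bumped_le`: in-block bonds =
   bump step + mismatch, face bonds = two bump face values `≤ 1/n`).
 * §3 **`reversePoincare`**: if `f := div_R D_R u` is such a field then `β₁^d‖f‖² = Re⟪βf, f⟫ ≤ ‖D_R(βf)‖‖D_R u‖` and `‖D_R u‖² = Re⟪u, f⟫ ≤ ‖u‖‖f‖` give
   `Σ_μ‖D_μu‖² ≤ 4d(1/n+w)²β₁^{−2d}·‖u‖²`, stated with the constant **`revPC d n w := 4d·36^d·(1 + n·w)²`** (d-ONLY in the class `n·w ≤ c_w`) as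
   **`n²·Σ_μ nsqv (D_μ u) ≤ revPC d n w · nsqv u`**.

HONEST FRAMING (T4-DAG p. 1).  Rung (B)+1 only — NOT infinite volume, NOT a mass gap, NOT Clay.  NE2 is NOT IN PRINT and NOT proved here.  MODEL LEVEL:
transports are DATA (c5: no identification with Bałaban's `U(Γ)` ∕ `R_k(U)` of [B9] (3.21)–(3.27)).  OURS and elementary ([folklore]); nothing printed is a
hypothesis; data `def`s `bumped`, `revPC` only; no `def … : Prop`; no `sorry`; axioms standard.  (GF3)∕V-P∕(SLICE-min) with background NOT addressed; V-END ∕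
NE2 NOT proved; NE3 OPEN; spine PROVED 0∕9.  HONEST DEPENDENCY (cell, verbatim): continuum YM on T⁴ ⇐ BetaPertH ∧ nine spine estimates (0/9 proved);
BetaPertH ⇐ (D1) ∧ (D4) ∧ CAP+tail; G-an2-4 gates asym, D1 and NE2/3/4.
-/

noncomputable section

namespace Summit.QuantumFields.BalabanUV.T4Continuum.CovariantBlockReversePoincare

open Finset WithLp
open scoped InnerProductSpace ComplexConjugate BigOperators
open Literature.MathematicalPhysics.QuantumFieldTheory.Balaban1983to89.B5Prop11Plancherel (Tor fine unitVec)
open Literature.MathematicalPhysics.QuantumFieldTheory.Balaban1983to89.B5Block118 (bpt)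
open Literature.MathematicalPhysics.QuantumFieldTheory.Balaban1983to89.B5Blocks16 (blockOf blockOf_bpt bpt_bijective sum_blocks)
open Literature.MathematicalPhysics.QuantumFieldTheory.Balaban1983to89.B5AverageCurlStokes (sum_blocks_real)
open Summit.QuantumFields.BalabanUV.T4Continuum.VariationalColourFederbush (cDv Qcv)
open Summit.QuantumFields.BalabanUV.T4Continuum.VariationalColourBochner
  (Dirv DirAdjv negLapv nsqv nsqv_nonneg ipv ipv_self conj_ipv ipv_sum_right norm_ipv_le ipv_DirAdjv inner_star_apply sum_sq_translate)
open Summit.QuantumFields.BalabanUV.T4Continuum.VariationalVectorWeitzenbock (divV divSq nsqV_eq_sum_nsqv)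
open Summit.QuantumFields.BalabanUV.T4Continuum.VariationalVectorGaugeSlice
  (avgOp avgOp_apply lapOp lapOp_apply lapOp_eq_negLapv sliceSub mem_sliceSub projG norm_toLp_sq)
open Summit.QuantumFields.BalabanUV.T4Continuum.VectorBlockTrialForm (nsqV nsqV_nonneg)
open Summit.QuantumFields.BalabanUV.T4Continuum.ScalarBlockTrialFunction
  (digits digits_bpt bpt_add_unitVec_of_lt bpt_add_unitVec_of_eq bump bump_mem bump_face abs_bump_step_le bumpW bumpW_mem bumpW_update prod_erase_mem
   beta1 beta1_ge sum_bumpW_eq)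

variable {d : ℕ}
variable {E : Type*} [NormedAddCommGroup E] [InnerProductSpace ℂ E]

/-! ## §1 The test-function inequality on any torus -/

section TestFunction

variable (N : Fin d → ℕ) [∀ μ, NeZero (N μ)] [CompleteSpace E]

omit [CompleteSpace E] in
/-- discrete Cauchy–Schwarz for the field pairing: `Re⟪g, f⟫ ≤ √(nsqv g)·√(nsqv f)`. [folklore] -/
theorem re_ipv_le (g f : Tor N → E) : (ipv N g f).re ≤ Real.sqrt (nsqv N g) * Real.sqrt (nsqv N f) := by
  have h1 : (ipv N g f).re ≤ ∑ x, ‖g x‖ * ‖f x‖ := (Complex.re_le_norm _).trans (norm_ipv_le N g f)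
  have h2 : (∑ x, ‖g x‖ * ‖f x‖) ^ 2 ≤ nsqv N g * nsqv N f := by
    unfold nsqv; exact Finset.sum_mul_sq_le_sq_mul_sq _ _ _
  have h3 : ∑ x, ‖g x‖ * ‖f x‖ ≤ Real.sqrt (nsqv N g * nsqv N f) := le_trans (le_abs_self _) (Real.abs_le_sqrt h2)
  rw [Real.sqrt_mul (nsqv_nonneg N g)] at h3
  exact h1.trans h3

omit [CompleteSpace E] in
/-- the same over the `d` directions: `Re Σ_μ ⟪A_μ, B_μ⟫ ≤ √(Σ_μ nsqv A_μ)·√(Σ_μ nsqv B_μ)`. [folklore] -/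
theorem re_sum_ipv_le (A B : Fin d → Tor N → E) :
    (∑ μ, ipv N (A μ) (B μ)).re ≤ Real.sqrt (∑ μ, nsqv N (A μ)) * Real.sqrt (∑ μ, nsqv N (B μ)) := by
  rw [Complex.re_sum]
  have h1 : ∑ μ, (ipv N (A μ) (B μ)).re ≤ ∑ μ, Real.sqrt (nsqv N (A μ)) * Real.sqrt (nsqv N (B μ)) :=
    sum_le_sum fun μ _ => re_ipv_le N (A μ) (B μ)
  have h2 : (∑ μ, Real.sqrt (nsqv N (A μ)) * Real.sqrt (nsqv N (B μ))) ^ 2 ≤ (∑ μ, nsqv N (A μ)) * ∑ μ, nsqv N (B μ) := by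
    have h := Finset.sum_mul_sq_le_sq_mul_sq Finset.univ (fun μ => Real.sqrt (nsqv N (A μ))) (fun μ => Real.sqrt (nsqv N (B μ)))
    simp only [Real.sq_sqrt (nsqv_nonneg N _)] at h
    exact h
  have h3 : ∑ μ, Real.sqrt (nsqv N (A μ)) * Real.sqrt (nsqv N (B μ)) ≤ Real.sqrt ((∑ μ, nsqv N (A μ)) * ∑ μ, nsqv N (B μ)) :=
    le_trans (le_abs_self _) (Real.abs_le_sqrt h2)
  rw [Real.sqrt_mul (sum_nonneg fun μ _ => nsqv_nonneg N (A μ))] at h3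
  exact h1.trans h3

/-- **adjointness summed**: `⟪ψ, div_R D_R u⟫ = Σ_μ ⟪D_μψ, D_μu⟫`. [folklore] -/
theorem ipv_negLapv (R : Tor N → Fin d → (E →L[ℂ] E)) (ψ u : Tor N → E) :
    ipv N ψ (negLapv N R u) = ∑ μ, ipv N (Dirv N R μ ψ) (Dirv N R μ u) := by
  have h : negLapv N R u = fun x => ∑ μ, DirAdjv N R μ (Dirv N R μ u) x := rfl
  rw [h, ipv_sum_right]
  exact sum_congr rfl fun μ _ => ipv_DirAdjv N R μ ψ _

/-- `div_R D_R` is symmetric for the field pairing: `⟪k, div_R D_R u⟫ = ⟪div_R D_R k, u⟫`. [folklore] -/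
theorem ipv_negLapv_comm (R : Tor N → Fin d → (E →L[ℂ] E)) (k u : Tor N → E) :
    ipv N k (negLapv N R u) = ipv N (negLapv N R k) u := by
  rw [← conj_ipv N u (negLapv N R k), ipv_negLapv, ipv_negLapv, map_sum]
  exact sum_congr rfl fun μ _ => (conj_ipv N _ _).symm

/-- the Dirichlet form is the pairing with `div_R D_R`: `Σ_μ nsqv (D_μ u) = Re⟪u, div_R D_R u⟫`. [folklore] -/
theorem sum_nsqv_Dirv_eq_re (R : Tor N → Fin d → (E →L[ℂ] E)) (u : Tor N → E) :
    ∑ μ, nsqv N (Dirv N R μ u) = (ipv N u (negLapv N R u)).re := by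
  rw [ipv_negLapv, Complex.re_sum]
  exact sum_congr rfl fun μ _ => by rw [ipv_self, Complex.ofReal_re]

/-- **THE TEST-FUNCTION INEQUALITY**: `Re⟪ψ, div_R D_R u⟫ ≤ √(Σ_μ nsqv (D_μψ))·√(Σ_μ nsqv (D_μu))`. [folklore] -/
theorem re_ipv_negLapv_le (R : Tor N → Fin d → (E →L[ℂ] E)) (ψ u : Tor N → E) :
    (ipv N ψ (negLapv N R u)).re ≤ Real.sqrt (∑ μ, nsqv N (Dirv N R μ ψ)) * Real.sqrt (∑ μ, nsqv N (Dirv N R μ u)) := by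
  rw [ipv_negLapv]
  exact re_sum_ipv_le N _ _

omit [∀ μ, NeZero (N μ)] [InnerProductSpace ℂ E] [CompleteSpace E] in
/-- squaring step: `a·F ≤ b·√F·√A` with `0 < a`, `0 ≤ F`, `0 ≤ A` forces `a²·F ≤ b²·A`. [folklore] -/
theorem sq_mul_le_of_le_sqrt {a b F A : ℝ} (ha : 0 < a) (hF : 0 ≤ F) (hA : 0 ≤ A)
    (h : a * F ≤ b * Real.sqrt F * Real.sqrt A) : a ^ 2 * F ≤ b ^ 2 * A := by
  rcases hF.eq_or_lt with hF0 | hFpos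
  · rw [← hF0, mul_zero]; positivity
  · have hs : 0 < Real.sqrt F := Real.sqrt_pos.mpr hFpos
    have h1 : a * Real.sqrt F ≤ b * Real.sqrt A := by
      have e : a * F = (a * Real.sqrt F) * Real.sqrt F := by rw [mul_assoc, Real.mul_self_sqrt hF]
      rw [e, mul_assoc b, mul_comm (Real.sqrt F) (Real.sqrt A), ← mul_assoc] at h
      exact le_of_mul_le_mul_right h hs
    have h2 := mul_self_le_mul_self (by positivity) h1
    have e1 : a * Real.sqrt F * (a * Real.sqrt F) = a ^ 2 * F := by
      rw [mul_mul_mul_comm, Real.mul_self_sqrt hF, sq]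
    have e2 : b * Real.sqrt A * (b * Real.sqrt A) = b ^ 2 * A := by
      rw [mul_mul_mul_comm, Real.mul_self_sqrt hA, sq]
    rwa [e1, e2] at h2

omit [∀ μ, NeZero (N μ)] [InnerProductSpace ℂ E] [CompleteSpace E] in
/-- duality step: `X ≤ √Y·√Z` and `c·Y ≤ b·X` (all nonnegative) force `c·X ≤ b·Z`. [folklore] -/
theorem mul_le_of_sqrt_chain {X Y Z b c : ℝ} (hX : 0 ≤ X) (hY : 0 ≤ Y) (hZ : 0 ≤ Z) (hb : 0 ≤ b) (hc : 0 ≤ c)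
    (h1 : X ≤ Real.sqrt Y * Real.sqrt Z) (h2 : c * Y ≤ b * X) : c * X ≤ b * Z := by
  have hsq : X * X ≤ Y * Z := by
    have h := mul_self_le_mul_self hX h1
    rwa [mul_mul_mul_comm, Real.mul_self_sqrt hY, Real.mul_self_sqrt hZ] at h
  rcases hX.eq_or_lt with hX0 | hXpos
  · rw [← hX0, mul_zero]; positivity
  · have h3 : c * X * X ≤ b * Z * X := by nlinarith [mul_le_mul_of_nonneg_left hsq hc, mul_le_mul_of_nonneg_right h2 hZ]
    exact le_of_mul_le_mul_right h3 hXpos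

end TestFunction

/-! ## §2 The bumped field on the block torus -/

section Bumped

variable (n : ℕ) [NeZero n] (M : Fin d → ℕ) [hM : ∀ μ, NeZero (M μ)]

/-- **the bumped field** `(bumped f)(x) = β(x)·f(x)`, `β = Π_ν b(digit_ν)` (leaf-09's `bumpW ∘ digits`). [folklore] -/
def bumped (f : Tor (fine n M) → E) : Tor (fine n M) → E := fun x => ((bumpW n (digits n M x) : ℝ) : ℂ) • f x

/-- `bumped f (n·y + j) = W(j)·f(n·y + j)`. [folklore] -/
theorem bumped_bpt (f : Tor (fine n M) → E) (y : Tor M) (j : Fin d → Fin n) :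
    bumped n M f (bpt n M y j) = ((bumpW n j : ℝ) : ℂ) • f (bpt n M y j) := by
  rw [bumped, digits_bpt]

/-- `Re⟪β·f, f⟫ = Σ_x β(x)·‖f x‖²`. [folklore] -/
theorem re_ipv_bumped_eq_sum (f : Tor (fine n M) → E) : (ipv (fine n M) (bumped n M f) f).re = ∑ x, bumpW n (digits n M x) * ‖f x‖ ^ 2 := by
  unfold ipv bumped
  rw [Complex.re_sum]
  refine sum_congr rfl fun x _ => ?_
  have h : ⟪f x, f x⟫_ℂ = ((‖f x‖ ^ 2 : ℝ) : ℂ) := by rw [inner_self_eq_norm_sq_to_K]; norm_cast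
  rw [inner_smul_left, h, Complex.conj_ofReal, ← Complex.ofReal_mul, Complex.ofReal_re]

/-- **block mean**: for a field with BLOCK-CONSTANT NORM, `Re⟪β·f, f⟫ = β₁^d·nsqv f`. [folklore] -/
theorem re_ipv_bumped {f : Tor (fine n M) → E} {G : Tor M → ℝ} (hG : ∀ x, ‖f x‖ = G (blockOf n M x)) :
    (ipv (fine n M) (bumped n M f) f).re = beta1 n ^ d * nsqv (fine n M) f := by
  have hcard : (Fintype.card (Fin d → Fin n) : ℝ) = (n : ℝ) ^ d := by
    rw [Fintype.card_fun, Fintype.card_fin, Fintype.card_fin]; push_cast; ring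
  rw [re_ipv_bumped_eq_sum]
  unfold nsqv
  rw [sum_blocks_real n M (fun x => bumpW n (digits n M x) * ‖f x‖ ^ 2), sum_blocks_real n M (fun x => ‖f x‖ ^ 2), mul_sum]
  refine sum_congr rfl fun y _ => ?_
  simp only [digits_bpt, hG, blockOf_bpt]
  rw [← sum_mul, sum_bumpW_eq n, sum_const, card_univ, nsmul_eq_mul, hcard, mul_pow]
  ring

/-- **one bond of the bumped field**: contractive `R`, in-block mismatch `w`, ANY field `f`:
`‖D_μ(β·f)(x)‖ ≤ n⁻¹·‖f(x+e_μ)‖ + (n⁻¹ + w)·‖f x‖`. [folklore] -/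
theorem norm_Dirv_bumped_le {R : Tor (fine n M) → Fin d → (E →L[ℂ] E)} (hR : ∀ x μ, ‖R x μ‖ ≤ 1) {f : Tor (fine n M) → E} {w : ℝ} (hw : 0 ≤ w)
    (hlip : ∀ (x : Tor (fine n M)) (μ : Fin d), blockOf n M (x + unitVec (fine n M) μ) = blockOf n M x →
      ‖R x μ (f (x + unitVec (fine n M) μ)) - f x‖ ≤ w * ‖f x‖)
    (x : Tor (fine n M)) (μ : Fin d) :
    ‖Dirv (fine n M) R μ (bumped n M f) x‖ ≤ (n : ℝ)⁻¹ * ‖f (x + unitVec (fine n M) μ)‖ + ((n : ℝ)⁻¹ + w) * ‖f x‖ := by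
  have hn : (0 : ℝ) < n := by exact_mod_cast Nat.pos_of_ne_zero (NeZero.ne n)
  have hn' : (0 : ℝ) ≤ (n : ℝ)⁻¹ := inv_nonneg.mpr hn.le
  -- write `x = n·y + j`
  obtain ⟨y, j, rfl⟩ : ∃ y j, bpt n M y j = x :=
    ⟨blockOf n M x, digits n M x, (Equiv.ofBijective _ (bpt_bijective n M)).apply_symm_apply x⟩  -- `RegionGaugeFixedVectorFlat.bpt_blockOf_digits`
  set P : ℝ := ∏ ν ∈ Finset.univ.erase μ, bump n (j ν) with hP
  have hP0 : 0 ≤ P := (prod_erase_mem n j μ).1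
  have hP1 : P ≤ 1 := (prod_erase_mem n j μ).2
  have hWj : bumpW n j = bump n (j μ) * P := (bumpW_update n j μ 0).2
  have hRf : ‖R (bpt n M y j) μ (f (bpt n M y j + unitVec (fine n M) μ))‖ ≤ ‖f (bpt n M y j + unitVec (fine n M) μ)‖ :=
    (ContinuousLinearMap.le_opNorm _ _).trans (by nlinarith [hR (bpt n M y j) μ, norm_nonneg (f (bpt n M y j + unitVec (fine n M) μ))])
  rw [VariationalColourBochner.Dirv_apply, bumped_bpt]
  by_cases h : (j μ : ℕ) + 1 < n
  · -- in-block bond: bump step + mismatch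
    set j' : Fin d → Fin n := Function.update j μ ⟨(j μ : ℕ) + 1, h⟩ with hj'
    have hstep : bpt n M y j + unitVec (fine n M) μ = bpt n M y j' := bpt_add_unitVec_of_lt n M y j μ h
    have hWj' : bumpW n j' = bump n ((j μ : ℕ) + 1) * P := (bumpW_update n j μ _).1
    have hblock : blockOf n M (bpt n M y j + unitVec (fine n M) μ) = blockOf n M (bpt n M y j) := by rw [hstep, blockOf_bpt, blockOf_bpt]
    have hmis := hlip (bpt n M y j) μ hblock
    have hdiff : |bumpW n j' - bumpW n j| ≤ (n : ℝ)⁻¹ := by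
      rw [hWj', hWj, ← sub_mul, abs_mul, abs_of_nonneg hP0]
      have h1 := abs_bump_step_le n (j μ) h
      rw [abs_mul, abs_of_pos hn] at h1
      have h2 : |bump n ((j μ : ℕ) + 1) - bump n (j μ)| ≤ (n : ℝ)⁻¹ := by
        rw [← one_div]; exact (le_div_iff₀' hn).mpr h1
      calc |bump n ((j μ : ℕ) + 1) - bump n (j μ)| * P ≤ (n : ℝ)⁻¹ * 1 := mul_le_mul h2 hP1 hP0 (by positivity)
        _ = (n : ℝ)⁻¹ := mul_one _
    have hW1 : 0 ≤ bumpW n j ∧ bumpW n j ≤ 1 := bumpW_mem n j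
    rw [hstep, bumped_bpt, map_smul]
    rw [hstep] at hmis hRf
    -- `β′•Rf′ − β•f = (β′ − β)•Rf′ + β•(Rf′ − f)`
    have e : ((bumpW n j' : ℝ) : ℂ) • R (bpt n M y j) μ (f (bpt n M y j')) - ((bumpW n j : ℝ) : ℂ) • f (bpt n M y j)
        = (((bumpW n j' - bumpW n j : ℝ)) : ℂ) • R (bpt n M y j) μ (f (bpt n M y j'))
          + ((bumpW n j : ℝ) : ℂ) • (R (bpt n M y j) μ (f (bpt n M y j')) - f (bpt n M y j)) := by
      push_cast; rw [sub_smul, smul_sub]; abel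
    rw [e]
    calc _ ≤ ‖(((bumpW n j' - bumpW n j : ℝ)) : ℂ) • R (bpt n M y j) μ (f (bpt n M y j'))‖
          + ‖((bumpW n j : ℝ) : ℂ) • (R (bpt n M y j) μ (f (bpt n M y j')) - f (bpt n M y j))‖ := norm_add_le _ _
      _ ≤ (n : ℝ)⁻¹ * ‖f (bpt n M y j')‖ + w * ‖f (bpt n M y j)‖ := by
          rw [norm_smul, norm_smul, Complex.norm_real, Complex.norm_real, Real.norm_eq_abs, Real.norm_eq_abs, abs_of_nonneg hW1.1]
          have t0 := mul_nonneg hw (norm_nonneg (f (bpt n M y j)))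
          exact add_le_add (mul_le_mul hdiff hRf (norm_nonneg _) hn')
            ((mul_le_mul_of_nonneg_left hmis hW1.1).trans (by nlinarith [hW1.2, hW1.1, t0]))
      _ ≤ _ := by nlinarith [mul_nonneg hn' (norm_nonneg (f (bpt n M y j)))]
  · -- face bond: both bump values are `≤ 1/n`
    have heq : (j μ : ℕ) + 1 = n := by have := (j μ).is_lt; omega
    set j' : Fin d → Fin n := Function.update j μ 0 with hj'
    have hstep : bpt n M y j + unitVec (fine n M) μ = bpt n M (y + unitVec M μ) j' := bpt_add_unitVec_of_eq n M y j μ heq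
    have hWj' : bumpW n j' = bump n ((0 : Fin n) : ℕ) * P := (bumpW_update n j μ 0).1
    have hb := bump_face n (j μ) heq
    have hβ' : 0 ≤ bumpW n j' ∧ bumpW n j' ≤ (n : ℝ)⁻¹ := by
      refine ⟨(bumpW_mem n j').1, ?_⟩
      rw [hWj', Fin.val_zero, hb.2, one_div]
      exact (mul_le_mul_of_nonneg_left hP1 (by positivity)).trans (by rw [mul_one])
    have hβ : 0 ≤ bumpW n j ∧ bumpW n j ≤ (n : ℝ)⁻¹ := by
      refine ⟨(bumpW_mem n j).1, ?_⟩
      rw [hWj, hb.1, one_div]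
      exact (mul_le_mul_of_nonneg_left hP1 (by positivity)).trans (by rw [mul_one])
    rw [hstep, bumped_bpt, map_smul]
    rw [hstep] at hRf
    calc _ ≤ ‖((bumpW n j' : ℝ) : ℂ) • R (bpt n M y j) μ (f (bpt n M (y + unitVec M μ) j'))‖ + ‖((bumpW n j : ℝ) : ℂ) • f (bpt n M y j)‖ :=
          norm_sub_le _ _
      _ ≤ (n : ℝ)⁻¹ * ‖f (bpt n M (y + unitVec M μ) j')‖ + (n : ℝ)⁻¹ * ‖f (bpt n M y j)‖ := by
          rw [norm_smul, norm_smul, Complex.norm_real, Complex.norm_real, Real.norm_eq_abs, Real.norm_eq_abs, abs_of_nonneg hβ'.1,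
            abs_of_nonneg hβ.1]
          exact add_le_add (mul_le_mul hβ'.2 hRf (norm_nonneg _) hn') (mul_le_mul_of_nonneg_right hβ.2 (norm_nonneg _))
      _ ≤ _ := by nlinarith [mul_nonneg hw (norm_nonneg (f (bpt n M y j)))]

/-- **Dirichlet form of the bumped field**: `Σ_μ nsqv (D_μ(β·f)) ≤ 4d·(n⁻¹ + w)²·nsqv f`. [folklore] -/
theorem sum_nsqv_Dirv_bumped_le {R : Tor (fine n M) → Fin d → (E →L[ℂ] E)} (hR : ∀ x μ, ‖R x μ‖ ≤ 1) {f : Tor (fine n M) → E} {w : ℝ} (hw : 0 ≤ w)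
    (hlip : ∀ (x : Tor (fine n M)) (μ : Fin d), blockOf n M (x + unitVec (fine n M) μ) = blockOf n M x →
      ‖R x μ (f (x + unitVec (fine n M) μ)) - f x‖ ≤ w * ‖f x‖) :
    ∑ μ, nsqv (fine n M) (Dirv (fine n M) R μ (bumped n M f)) ≤ 4 * d * ((n : ℝ)⁻¹ + w) ^ 2 * nsqv (fine n M) f := by
  have hn : (0 : ℝ) < n := by exact_mod_cast Nat.pos_of_ne_zero (NeZero.ne n)
  have hμ : ∀ μ : Fin d, nsqv (fine n M) (Dirv (fine n M) R μ (bumped n M f)) ≤ 4 * ((n : ℝ)⁻¹ + w) ^ 2 * nsqv (fine n M) f := by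
    intro μ
    unfold nsqv
    calc ∑ x, ‖Dirv (fine n M) R μ (bumped n M f) x‖ ^ 2
        ≤ ∑ x, (2 * ((n : ℝ)⁻¹ ^ 2 * ‖f (x + unitVec (fine n M) μ)‖ ^ 2) + 2 * (((n : ℝ)⁻¹ + w) ^ 2 * ‖f x‖ ^ 2)) := by
          refine sum_le_sum fun x _ => ?_
          have h := norm_Dirv_bumped_le n M hR hw hlip x μ
          have h0 : 0 ≤ ‖Dirv (fine n M) R μ (bumped n M f) x‖ := norm_nonneg _
          calc ‖Dirv (fine n M) R μ (bumped n M f) x‖ ^ 2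
              ≤ ((n : ℝ)⁻¹ * ‖f (x + unitVec (fine n M) μ)‖ + ((n : ℝ)⁻¹ + w) * ‖f x‖) ^ 2 := pow_le_pow_left₀ h0 h 2
            _ ≤ _ := by nlinarith [sq_nonneg ((n : ℝ)⁻¹ * ‖f (x + unitVec (fine n M) μ)‖ - ((n : ℝ)⁻¹ + w) * ‖f x‖)]
      _ = 2 * ((n : ℝ)⁻¹ ^ 2) * ∑ x, ‖f x‖ ^ 2 + 2 * ((n : ℝ)⁻¹ + w) ^ 2 * ∑ x, ‖f x‖ ^ 2 := by
          rw [sum_add_distrib, ← mul_sum, ← mul_sum, ← mul_sum, ← mul_sum, sum_sq_translate (fine n M) f (unitVec (fine n M) μ)]; ring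
      _ ≤ 4 * ((n : ℝ)⁻¹ + w) ^ 2 * ∑ x, ‖f x‖ ^ 2 := by
          have hs : 0 ≤ ∑ x, ‖f x‖ ^ 2 := sum_nonneg fun x _ => by positivity
          have h1 : (n : ℝ)⁻¹ ^ 2 ≤ ((n : ℝ)⁻¹ + w) ^ 2 := pow_le_pow_left₀ (by positivity) (by linarith) 2
          nlinarith [mul_le_mul_of_nonneg_right h1 hs]
  calc ∑ μ, nsqv (fine n M) (Dirv (fine n M) R μ (bumped n M f)) ≤ ∑ _μ : Fin d, 4 * ((n : ℝ)⁻¹ + w) ^ 2 * nsqv (fine n M) f :=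
        sum_le_sum fun μ _ => hμ μ
    _ = 4 * d * ((n : ℝ)⁻¹ + w) ^ 2 * nsqv (fine n M) f := by rw [sum_const, card_univ, Fintype.card_fin, nsmul_eq_mul]; ring

end Bumped

/-! ## §3 The reverse Poincaré inequality -/

section Reverse

variable (n : ℕ) [NeZero n] (M : Fin d → ℕ) [hM : ∀ μ, NeZero (M μ)] [CompleteSpace E]

/-- the reverse Poincaré constant `C₁ = 4d·36^d·(1 + n·w)²` (d-only in the mismatch class `n·w ≤ c_w`). [folklore] -/
def revPC (d n : ℕ) (w : ℝ) : ℝ := 4 * d * 36 ^ d * (1 + n * w) ^ 2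

omit [NeZero n] in
/-- `0 ≤ C₁`. [folklore] -/
theorem revPC_nonneg (w : ℝ) : 0 ≤ revPC d n w := by unfold revPC; positivity

/-- the sharp-ish constant is below `C₁/n²`: `4d(n⁻¹ + w)²/β₁^{2d} ≤ C₁·(n²)⁻¹`. [folklore] -/
theorem sharp_le_revPC {w : ℝ} (hw : 0 ≤ w) : 4 * d * ((n : ℝ)⁻¹ + w) ^ 2 / (beta1 n ^ d) ^ 2 ≤ revPC d n w * ((n : ℝ) ^ 2)⁻¹ := by
  have hn : (0 : ℝ) < n := by exact_mod_cast Nat.pos_of_ne_zero (NeZero.ne n)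
  have hb := beta1_ge n
  have hbd : (1 / 6 : ℝ) ^ d ≤ beta1 n ^ d := pow_le_pow_left₀ (by norm_num) hb.1 d
  have hbd0 : 0 < (1 / 6 : ℝ) ^ d := by positivity
  have h36 : ((beta1 n ^ d) ^ 2)⁻¹ ≤ (36 : ℝ) ^ d := by
    have h1 : ((1 / 6 : ℝ) ^ d) ^ 2 ≤ (beta1 n ^ d) ^ 2 := pow_le_pow_left₀ hbd0.le hbd 2
    have h2 : ((beta1 n ^ d) ^ 2)⁻¹ ≤ (((1 / 6 : ℝ) ^ d) ^ 2)⁻¹ := inv_anti₀ (by positivity) h1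
    have e : (((1 / 6 : ℝ) ^ d) ^ 2)⁻¹ = 36 ^ d := by
      rw [one_div, inv_pow, inv_pow, inv_inv, ← pow_mul, mul_comm d 2, pow_mul]; norm_num
    rwa [e] at h2
  have e1 : ((n : ℝ)⁻¹ + w) ^ 2 = (1 + n * w) ^ 2 * ((n : ℝ) ^ 2)⁻¹ := by field_simp
  rw [div_eq_mul_inv, e1, revPC]
  have h0 : 0 ≤ 4 * (d : ℝ) * ((1 + n * w) ^ 2 * ((n : ℝ) ^ 2)⁻¹) := by positivity
  calc 4 * (d : ℝ) * ((1 + n * w) ^ 2 * ((n : ℝ) ^ 2)⁻¹) * ((beta1 n ^ d) ^ 2)⁻¹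
      ≤ 4 * (d : ℝ) * ((1 + n * w) ^ 2 * ((n : ℝ) ^ 2)⁻¹) * 36 ^ d := mul_le_mul_of_nonneg_left h36 h0
    _ = _ := by ring

/-- **THE COVARIANT REVERSE POINCARÉ INEQUALITY** (model level; ANY Hilbert `E`): contractive bond transports `R`; a 0-form `u` whose `div_R D_R u =: f` has
BLOCK-CONSTANT NORM and IN-BLOCK covariant differences `≤ w·‖f‖` (this is what `f ⊥ ker Q_{T′}` gives, §4).  Then

  `n² · Σ_μ nsqv (D_μ u) ≤ 4d·36^d·(1 + n·w)² · nsqv u`.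

Route: `β₁^d‖f‖² = Re⟪βf, f⟫ ≤ ‖D_R(βf)‖‖D_R u‖ ≤ 2√d(n⁻¹+w)‖f‖‖D_R u‖` and `‖D_R u‖² = Re⟪u, f⟫ ≤ ‖u‖‖f‖`. [folklore] -/
theorem reversePoincare {R : Tor (fine n M) → Fin d → (E →L[ℂ] E)} (hR : ∀ x μ, ‖R x μ‖ ≤ 1) {u : Tor (fine n M) → E} {G : Tor M → ℝ} {w : ℝ}
    (hw : 0 ≤ w) (hG : ∀ x, ‖negLapv (fine n M) R u x‖ = G (blockOf n M x))
    (hlip : ∀ (x : Tor (fine n M)) (μ : Fin d), blockOf n M (x + unitVec (fine n M) μ) = blockOf n M x →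
      ‖R x μ (negLapv (fine n M) R u (x + unitVec (fine n M) μ)) - negLapv (fine n M) R u x‖ ≤ w * ‖negLapv (fine n M) R u x‖) :
    (n : ℝ) ^ 2 * ∑ μ, nsqv (fine n M) (Dirv (fine n M) R μ u) ≤ revPC d n w * nsqv (fine n M) u := by
  have hn : (0 : ℝ) < n := by exact_mod_cast Nat.pos_of_ne_zero (NeZero.ne n)
  set f := negLapv (fine n M) R u with hf
  set A : ℝ := ∑ μ, nsqv (fine n M) (Dirv (fine n M) R μ u) with hA
  set F : ℝ := nsqv (fine n M) f with hF
  set U : ℝ := nsqv (fine n M) u with hU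
  set b : ℝ := 2 * Real.sqrt d * ((n : ℝ)⁻¹ + w) with hb
  have hA0 : 0 ≤ A := sum_nonneg fun μ _ => nsqv_nonneg _ _
  have hF0 : 0 ≤ F := nsqv_nonneg _ _
  have hU0 : 0 ≤ U := nsqv_nonneg _ _
  have hb0 : 0 ≤ b := by positivity
  have hb2 : b ^ 2 = 4 * d * ((n : ℝ)⁻¹ + w) ^ 2 := by
    rw [hb, mul_pow, mul_pow, Real.sq_sqrt (Nat.cast_nonneg d)]; ring
  have hβd : 0 < beta1 n ^ d := pow_pos (beta1_ge n).2 d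
  -- the Dirichlet form of the bumped field: `√(Σ‖D(βf)‖²) ≤ b·√F`
  have hD : Real.sqrt (∑ μ, nsqv (fine n M) (Dirv (fine n M) R μ (bumped n M f))) ≤ b * Real.sqrt F := by
    have h := sum_nsqv_Dirv_bumped_le n M hR hw hlip
    have e : 4 * (d : ℝ) * ((n : ℝ)⁻¹ + w) ^ 2 * F = (b * Real.sqrt F) ^ 2 := by
      rw [mul_pow, Real.sq_sqrt hF0, hb2]
    rw [← hF, e] at h
    exact (Real.sqrt_le_sqrt h).trans (by rw [Real.sqrt_sq (by positivity)])
  -- step 1: `β₁^d·F = Re⟪βf, f⟫ ≤ b·√F·√A`, hence `β₁^{2d}·F ≤ b²·A`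
  have h1 : beta1 n ^ d * F ≤ b * Real.sqrt F * Real.sqrt A := by
    have h := re_ipv_negLapv_le (fine n M) R (bumped n M f) u
    rw [← hf, re_ipv_bumped n M hG] at h
    exact h.trans (mul_le_mul_of_nonneg_right hD (Real.sqrt_nonneg _))
  have h1' : (beta1 n ^ d) ^ 2 * F ≤ b ^ 2 * A := sq_mul_le_of_le_sqrt hβd hF0 hA0 h1
  -- step 2: `A = Re⟪u, f⟫ ≤ √F·√U`, hence `β₁^{2d}·A ≤ b²·U`
  have h2 : A ≤ Real.sqrt F * Real.sqrt U := by
    rw [hA, sum_nsqv_Dirv_eq_re, mul_comm]; exact re_ipv_le (fine n M) u f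
  have h3 : (beta1 n ^ d) ^ 2 * A ≤ b ^ 2 * U := mul_le_of_sqrt_chain hA0 hF0 hU0 (sq_nonneg b) (sq_nonneg _) h2 h1'
  -- constants: `b²/β₁^{2d} ≤ C₁/n²`
  have h4 : A ≤ 4 * d * ((n : ℝ)⁻¹ + w) ^ 2 / (beta1 n ^ d) ^ 2 * U := by
    rw [div_mul_eq_mul_div, le_div_iff₀ (by positivity), ← hb2]; linarith [h3]
  have h5 : A ≤ revPC d n w * ((n : ℝ) ^ 2)⁻¹ * U := h4.trans (mul_le_mul_of_nonneg_right (sharp_le_revPC n hw) hU0)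
  calc (n : ℝ) ^ 2 * A ≤ (n : ℝ) ^ 2 * (revPC d n w * ((n : ℝ) ^ 2)⁻¹ * U) := mul_le_mul_of_nonneg_left h5 (by positivity)
    _ = revPC d n w * U := by field_simp

end Reverse

end Summit.QuantumFields.BalabanUV.T4Continuum.CovariantBlockReversePoincare

end
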